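import Mathlib
import HarnessLib
import Summits.ResolutionOfSingularities.ResolutionOfSingularities.Theorems.WildQuotientsWildQuotientResolutionS1aKillMoveWins
import Summits.ResolutionOfSingularities.ResolutionOfSingularities.Theorems.WildQuotientsWildQuotientResolutionS1aTerminalLocus

/-!
# S1a — (T5-lite) THE MEASURE `ν₁` DROPS UNDER A KILL MOVE; the crux reduced to the existence of component-hitting kill centres

[OURS · L1 W4.5c · lead-1 g7; plan-1 STRATEGY-DESIGN v2 §3/§5 (μ̂ first component `ν₁ = dim Z(M)`), CHAIN v10.3 §4 row
`stub_winningStrategy`] — NOT statements of the manuscript; counted 0; AI-level work, weaker than expert review.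
Crux stmt-ResolutionOfSingularities-17941, line `s1a-logminvertex` v6.

* `topologicalKrullDim_diff_lt` — TOPOLOGY: if an open `U` meets every irreducible component of (the subspace) `Z`, then
  `dim (Z ∖ U) < dim Z` (any chain of irreducible closed subsets of `Z ∖ U` is topped by a component of `Z`, which is not in `Z ∖ U`);
* `isInducing_badLocus_move` — for a move `π' : Mʼ → M` along a KILL centre, `Z(Mʼ) → Z(M) ∖ ⋃ kill charts`, `v' ↦ π' v'`, is a
  topological embedding (inducing): `π'` is an isomorphism off the support of the centre (`IsBlowup.isIso_morphismRestrict`) and `Z(Mʼ)`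
  lies over the idle region (`GModel.mem_badLocus_of_move`, `…S1aKillMoveWins`);
* **`nu1_move_lt`** — hence if the kill charts meet every irreducible component of `Z(M)`: `ν₁(Mʼ) < n` whenever `ν₁(M) ≤ n`;
* **`wins_of_killCentres`** — THE CRUX REDUCED: if along an invariant `P ∋ M₀` every non-terminal model admits a kill centre whose kill
  charts meet every irreducible component of its bad locus (and `P` is preserved by its moves), then `M₀` WINS (`GameFrame.Wins`),
  by induction on `ν₁` — what remains of `stub_winningStrategy` is this EXISTENCE statement ((R0) centre rule, STRATEGY-DESIGN v2).
-/

set_option linter.dupNamespace false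

noncomputable section

open CategoryTheory AlgebraicGeometry TopologicalSpace Topology
open Literature.AlgebraicGeometry.Resolution Literature.AlgebraicGeometry.RelativeSpec
open Summit.ResolutionOfSingularities.ResolutionOfSingularities.Theorems.WildQuotientResolution.S1
open Summit.ResolutionOfSingularities.ResolutionOfSingularities.Theorems.WildQuotientResolution.S1.NodeAtlas
open Summit.ResolutionOfSingularities.ResolutionOfSingularities.Theorems.WildQuotientResolution.S1.BlowupCharts

namespace Summit.ResolutionOfSingularities.ResolutionOfSingularities.Theorems.WildQuotientResolution.S1

universe u

/-! ## Topology: removing an open that meets every component drops the dimension -/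

/-- **`dim (Z ∖ U) < dim Z`** when the open `U` meets every irreducible component of the subspace `Z` (and `dim Z ≤ n < ∞`).
[OURS · L1 W4.5c] -/
theorem topologicalKrullDim_diff_lt {V : Type u} [TopologicalSpace V] (Z U : Set V) (hU : IsOpen U)
    (hmeet : ∀ t ∈ irreducibleComponents ↥Z, ∃ x ∈ t, (x : V) ∈ U) {n : ℕ} (hn : topologicalKrullDim ↥Z ≤ n) :
    topologicalKrullDim ↥(Z \ U) < n := by
  rw [topologicalKrullDim, Order.krullDim_lt_coe_iff]
  intro l
  -- push the chain into `Z`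
  have hsub : Z \ U ⊆ Z := fun _ hx => hx.1
  let ι : ↥(Z \ U) → ↥Z := Set.inclusion hsub
  have hι : IsInducing ι := (IsEmbedding.inclusion hsub).isInducing
  let f : IrreducibleCloseds ↥(Z \ U) → IrreducibleCloseds ↥Z := IrreducibleCloseds.map ι hι.continuous
  have hf : StrictMono f := IrreducibleCloseds.map_strictMono_of_isInducing hι
  let l₁ := l.map f hf
  -- the top of the pushed chain misses `U`
  have hlast : ((l₁.last : IrreducibleCloseds ↥Z) : Set ↥Z) ⊆ {x | (x : V) ∉ U} := by
    rw [LTSeries.last_map, IrreducibleCloseds.coe_map]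
    refine closure_minimal ?_ (hU.preimage continuous_subtype_val).isClosed_compl
    rintro _ ⟨y, -, rfl⟩
    exact y.2.2
  -- a component of `Z` above it
  obtain ⟨t, ht, hlt, hmax⟩ := exists_preirreducible (l₁.last : Set ↥Z) l₁.last.isIrreducible.isPreirreducible
  have htirr : IsIrreducible t := ⟨l₁.last.isIrreducible.nonempty.mono hlt, ht⟩
  have htcl : IsClosed t := by
    rw [← closure_eq_iff_isClosed]
    exact hmax _ ht.closure subset_closure
  have htcomp : t ∈ irreducibleComponents ↥Z := ⟨htirr, fun u hu htu => (hmax u hu.isPreirreducible htu).le⟩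
  obtain ⟨x, hxt, hxU⟩ := hmeet t htcomp
  let K : IrreducibleCloseds ↥Z := ⟨t, htirr, htcl⟩
  have hK : l₁.last < K := by
    refine lt_of_le_of_ne hlt fun h => ?_
    have : x ∈ (l₁.last : Set ↥Z) := by rw [h]; exact hxt
    exact hlast this hxU
  -- the longer chain
  have := Order.LTSeries.length_le_krullDim (l₁.snoc K hK)
  simp only [RelSeries.snoc_length, LTSeries.map_length, l₁] at this
  have h2 : ((l.length + 1 : ℕ) : WithBot ℕ∞) ≤ (n : WithBot ℕ∞) := this.trans hn
  have h3 : l.length + 1 ≤ n := by exact_mod_cast h2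
  omega

/-! ## The bad locus of a kill move embeds into the part of `Z(M)` missed by the kill charts -/

namespace GameFrame.GModel

variable {p : ℕ} {X' X₁ : Scheme.{0}} {q : X' ⟶ X₁} {G : Type} [Group G] {ρ : G →* Aut X'} {g₀ : G}

/-- The union of the kill-centre charts of `(𝒦, d)`. -/
def killOpen (M : GModel p q G ρ g₀) (𝒦 : ReesFiltration M.V) (d : ℕ) : Set M.V :=
  ⋃ (O : M.act.StableAffineOpens) (_ : IsKillCentreChart p M.act g₀ 𝒦 d O), (O.1 : Set M.V)

/-- The union of the kill-centre charts is open. -/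
theorem isOpen_killOpen (M : GModel p q G ρ g₀) (𝒦 : ReesFiltration M.V) (d : ℕ) : IsOpen (M.killOpen 𝒦 d) :=
  isOpen_iUnion fun O => isOpen_iUnion fun _ => O.1.isOpen

/-- **The bad locus of a kill move embeds into `Z(M) ∖ ⋃ kill charts`.** [OURS · L1 W4.5c] -/
theorem exists_isInducing_badLocus_move [Finite G] (hp : p.Prime) (hG : ∀ g : G, g ∈ Subgroup.zpowers g₀)
    (M M' : GModel p q G ρ g₀) (𝒦 : ReesFiltration M.V) (d : ℕ) (hkill : IsKillCentre p M.act g₀ 𝒦 d)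
    (π' : M'.V ⟶ M.V) (hbl : IsBlowup π' (𝒦.ideal d)) (hr : M'.r = π' ≫ M.r)
    (hcomm : ∀ g : G, (M'.act.aut g).hom ≫ π' = π' ≫ (M.act.aut g).hom)
    {R₀ : Type} [CommRing R₀] [IsNoetherianRing R₀] (s : M.V ⟶ Spec (.of R₀)) [LocallyOfFiniteType s]
    (hs : ∀ g : G, (M.act.aut g).hom ≫ s = s) :
    ∃ φ : ↥M'.badLocus → ↥(M.badLocus \ M.killOpen 𝒦 d), IsInducing φ := by
  -- where bad points go
  have hmem : ∀ v' : ↥M'.badLocus, π'.base v'.1 ∈ M.badLocus \ M.killOpen 𝒦 d := fun v' => by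
    obtain ⟨hbad, hno⟩ := mem_badLocus_of_move hp hG M M' 𝒦 d hkill π' hbl hr hcomm s hs v'.2
    refine ⟨hbad, fun h => ?_⟩
    obtain ⟨O, hO⟩ := Set.mem_iUnion.mp h
    obtain ⟨hO, hvO⟩ := Set.mem_iUnion.mp hO
    exact hno O hO hvO
  -- the idle region `W` = complement of the support, over which `π'` is an isomorphism
  let W : M.V.Opens := (𝒦.ideal d).support.compl
  haveI hiso : IsIso (π' ∣_ W) := hbl.isIso_morphismRestrict (U := W) (by
    rw [Set.disjoint_iff]; rintro x ⟨hx, hx'⟩; exact hx hx')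
  have hW : ∀ v' : ↥M'.badLocus, v'.1 ∈ π' ⁻¹ᵁ W := fun v' => by
    obtain ⟨hbad, hno⟩ := mem_badLocus_of_move hp hG M M' 𝒦 d hkill π' hbl hr hcomm s hs v'.2
    obtain ⟨O, hvO, hO | hO⟩ := hkill.2.2 (π'.base v'.1)
    · exact absurd hvO (hno O hO)
    · change π'.base v'.1 ∈ ((𝒦.ideal d).support : Set M.V)ᶜ
      have hdisj := disjoint_support_of_ideal_eq_top (I := 𝒦.ideal d) hO.1.1
        (by rw [← ReesFiltration.filtration_ideal]; exact hO.2 d)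
      exact Set.disjoint_left.mp hdisj hvO
  -- the embedding: `Z(M') ⊆ π'⁻¹ W ≃ W ⊆ V`
  let e : ↥(π' ⁻¹ᵁ W) ≃ₜ ↥W := Scheme.homeoOfIso (asIso (π' ∣_ W))
  let φ₀ : ↥M'.badLocus → M.V := fun v' => ((e ⟨v'.1, hW v'⟩ : ↥W) : M.V)
  have hφ₀ : ∀ v', φ₀ v' = π'.base v'.1 := fun v' => by
    have h1 : (e ⟨v'.1, hW v'⟩ : ↥W) = (π' ∣_ W).base ⟨v'.1, hW v'⟩ := rfl
    change ((e ⟨v'.1, hW v'⟩ : ↥W) : M.V) = _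
    rw [h1]
    exact morphismRestrict_base_coe π' W ⟨v'.1, hW v'⟩
  have hind₀ : IsInducing φ₀ := by
    refine IsInducing.subtypeVal.comp (e.isInducing.comp ?_)
    exact (IsInducing.subtypeVal.codRestrict hW : IsInducing fun v' : ↥M'.badLocus => (⟨v'.1, hW v'⟩ : ↥(π' ⁻¹ᵁ W)))
  have hmem₀ : ∀ v', φ₀ v' ∈ M.badLocus \ M.killOpen 𝒦 d := fun v' => by rw [hφ₀]; exact hmem v'
  exact ⟨Set.codRestrict φ₀ _ hmem₀, hind₀.codRestrict hmem₀⟩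

/-- **`ν₁` DROPS UNDER A KILL MOVE WHOSE KILL CHARTS MEET EVERY IRREDUCIBLE COMPONENT OF `Z(M)`**: if `ν₁(M) ≤ n` then
`ν₁(Mʼ) < n` for every move `Mʼ`. [OURS · L1 W4.5c] -/
theorem nu1_move_lt [Finite G] (hp : p.Prime) (hG : ∀ g : G, g ∈ Subgroup.zpowers g₀)
    (M M' : GModel p q G ρ g₀) (𝒦 : ReesFiltration M.V) (d : ℕ) (hkill : IsKillCentre p M.act g₀ 𝒦 d)
    (hhit : ∀ t ∈ irreducibleComponents ↥M.badLocus, ∃ x ∈ t, (x : M.V) ∈ M.killOpen 𝒦 d)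
    (π' : M'.V ⟶ M.V) (hbl : IsBlowup π' (𝒦.ideal d)) (hr : M'.r = π' ≫ M.r)
    (hcomm : ∀ g : G, (M'.act.aut g).hom ≫ π' = π' ≫ (M.act.aut g).hom)
    {R₀ : Type} [CommRing R₀] [IsNoetherianRing R₀] (s : M.V ⟶ Spec (.of R₀)) [LocallyOfFiniteType s]
    (hs : ∀ g : G, (M.act.aut g).hom ≫ s = s) {n : ℕ} (hn : M.nu1 ≤ n) : M'.nu1 < n := by
  obtain ⟨φ, hφ⟩ := exists_isInducing_badLocus_move hp hG M M' 𝒦 d hkill π' hbl hr hcomm s hs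
  exact lt_of_le_of_lt hφ.topologicalKrullDim_le
    (topologicalKrullDim_diff_lt M.badLocus (M.killOpen 𝒦 d) (M.isOpen_killOpen 𝒦 d) hhit hn)

/-! ## The crux reduced to the existence of component-hitting kill centres -/

/-- A model is of FINITE TYPE OVER A NOETHERIAN AFFINE BASE on which `G` acts trivially (the standing finiteness hypothesis of the
(T2e) chain; in the game: `M.V → X₁ → Spec k`). [OURS · L1 W4.5c] -/
def HasNoetherianBase (M : GModel p q G ρ g₀) : Prop :=
  ∃ (R₀ : Type) (_ : CommRing R₀) (_ : IsNoetherianRing R₀) (s : M.V ⟶ Spec (.of R₀)) (_ : LocallyOfFiniteType s),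
    ∀ g : G, (M.act.aut g).hom ≫ s = s

/-- `x < m + 1 ⇒ x ≤ m` in `WithBot ℕ∞` for natural `m`. -/
theorem withBot_le_of_lt_succ {x : WithBot ℕ∞} {m : ℕ} (h : x < ((m + 1 : ℕ) : WithBot ℕ∞)) : x ≤ (m : WithBot ℕ∞) := by
  induction x using WithBot.recBotCoe with
  | bot => exact bot_le
  | coe y =>
    rw [← WithBot.coe_natCast, WithBot.coe_lt_coe, Nat.cast_succ] at h
    rw [← WithBot.coe_natCast, WithBot.coe_le_coe]
    exact (ENat.lt_add_one_iff (ENat.coe_ne_top m)).mp h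

/-- `ν₁ < 0 ⇒` terminal. -/
theorem terminal_of_nu1_lt_zero (M : GModel p q G ρ g₀) (h : M.nu1 < ((0 : ℕ) : WithBot ℕ∞)) : M.Terminal := by
  rw [← nu1_eq_bot_iff]
  induction hM : M.nu1 using WithBot.recBotCoe with
  | bot => rfl
  | coe y =>
    rw [hM, ← WithBot.coe_natCast, WithBot.coe_lt_coe, Nat.cast_zero] at h
    exact absurd h (by simp)

/-- **THE CRUX REDUCED (kill-game form).** Let `G = ⟨g₀⟩` be finite, `p` prime, and `P` a property of models such that every
non-terminal `P`-model of finite type over a Noetherian base admits a KILL centre whose kill-centre charts meet every irreducible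
component of its bad locus, all of whose moves are again `P`-models over a Noetherian base. Then every `P`-model with finite `ν₁`
WINS the kill game (`GameFrame.Wins`) — by induction on `ν₁`. What `stub_winningStrategy` still needs is exactly the hypothesis `H`
((R0) centre rule of STRATEGY-DESIGN v2) for the reachable models of each datum. [OURS · L1 W4.5c] -/
theorem wins_of_killCentres [Finite G] (hp : p.Prime) (hG : ∀ g : G, g ∈ Subgroup.zpowers g₀)
    (P : GModel p q G ρ g₀ → Prop)
    (H : ∀ M : GModel p q G ρ g₀, P M → M.HasNoetherianBase → ¬ M.Terminal →
      ∃ (𝒦 : ReesFiltration M.V) (d : ℕ), IsKillCentre p M.act g₀ 𝒦 d ∧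
        (∀ t ∈ irreducibleComponents ↥M.badLocus, ∃ x ∈ t, (x : M.V) ∈ M.killOpen 𝒦 d) ∧
        ∀ M' : GModel p q G ρ g₀, M.IsMoveOf M' 𝒦 d → P M' ∧ M'.HasNoetherianBase)
    (M₀ : GModel p q G ρ g₀) (hP₀ : P M₀) (hB₀ : M₀.HasNoetherianBase) {n₀ : ℕ} (hn₀ : M₀.nu1 < n₀) :
    Wins p q G ρ g₀ M₀ := by
  suffices h : ∀ (n : ℕ) (M : GModel p q G ρ g₀), P M → M.HasNoetherianBase → M.nu1 < n → Wins p q G ρ g₀ M from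
    h n₀ M₀ hP₀ hB₀ hn₀
  intro n
  induction n with
  | zero => exact fun M _ _ hn => Wins.terminal M (M.terminal_of_nu1_lt_zero hn)
  | succ n ih =>
    intro M hPM hBM hn
    by_cases hT : M.Terminal
    · exact Wins.terminal M hT
    obtain ⟨𝒦, d, hkill, hhit, hmoves⟩ := H M hPM hBM hT
    refine Wins.of_moves 𝒦 d (isAdmissibleCentre_of_isKillCentre hkill) fun M' hmv => ?_
    obtain ⟨hPM', hBM'⟩ := hmoves M' hmv
    obtain ⟨π', hbl, -, hr, hcomm⟩ := hmv
    obtain ⟨R₀, _, _, s, _, hs⟩ := hBM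
    have hn' : M.nu1 ≤ n := withBot_le_of_lt_succ hn
    exact ih M' hPM' hBM' (nu1_move_lt hp hG M M' 𝒦 d hkill hhit π' hbl hr hcomm s hs hn')

end GameFrame.GModel

end Summit.ResolutionOfSingularities.ResolutionOfSingularities.Theorems.WildQuotientResolution.S1

end
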